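import Summits.BirchSwinnertonDyer.BirchSwinnertonDyer.Theorems.SignedBaseChangeAnticyclotomicEisensteinDivisibilityXAcTorsionSignedCarrier
import Summits.BirchSwinnertonDyer.BirchSwinnertonDyer.Theorems.SignedBaseChangeAnticyclotomicEisensteinDivisibilityXAcTorsionSignedRank
import Summits.BirchSwinnertonDyer.BirchSwinnertonDyer.Theorems.SignedBaseChangeAnticyclotomicEisensteinDivisibilityAnticyclotomicNonsplit
import Summits.BirchSwinnertonDyer.BirchSwinnertonDyer.Theorems.UniversalToricDescentSignedSettingNoPTorsion
import Summits.BirchSwinnertonDyer.BirchSwinnertonDyer.Theorems.UniversalToricDescentTwinFullThreeAdicImageOverK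
import Summits.BirchSwinnertonDyer.BirchSwinnertonDyer.Theorems.EisensteinPrimesTwistDeformationFullAtSelmerOfFacts
import Literature.NumberTheory.EllipticCurves.AnticyclotomicSignedTransferInputs
import Literature.NumberTheory.EllipticCurves.BSDSelmerPConverseSerreProofs
import Literature.NumberTheory.EllipticCurves.ZywinaCMImageProofs
import Summits.BirchSwinnertonDyer.BirchSwinnertonDyer.Theorems.SignedBaseChangeAnticyclotomicEisensteinDivisibilityEisensteinTransfer
import Summits.BirchSwinnertonDyer.BirchSwinnertonDyer.Theorems.SignedBaseChangeAnticyclotomicEisensteinDivisibilityTransferSideInjective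
import Literature.NumberTheory.EllipticCurves.AnticyclotomicSignedSelmerRelaxedEquality
import Literature.NumberTheory.EllipticCurves.CastellaWan2024.GreenbergMainConjectureBDP
import Literature.NumberTheory.EllipticCurves.ModularCurveNonempty
import HarnessLib

/-!
# Line `admdef`, stub `stub_chkllPlusRatNS` (C⁺⁺_NS): the CORRECTED certified cut — C⁺⁺_NS from
# Form T_β (the `±`-currency Eisenstein inclusion WITH the BDP frame hypothesis) and four PRINTED facts
# (crux `AnticyclotomicEisensteinDivisibility`, stmt-BirchSwinnertonDyer-20727)

Lead seat bsd-line-sbc-p1 (gen 15), `--supports stmt-BirchSwinnertonDyer-20727`. The admdef supplement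
(`Cruxes/…/Lines/admdef_transfer.lean` rev 2) certified `C⁺⁺ ⟸ [R] + conj 3 + conj 5` with [R] a
`∀ (z, L)`-statement carrying the ranks as CONCLUSIONS and no frame hypothesis; the sibling file
`…TransferInputsRescaling.lean` (p723445) shows that shape is inconsistent (the class binder rescales).
THIS FILE is the corrected cut, kernel-checked: the research input is **Form T_β** — for every Castella–Wan
BDP frame `(Ω_K ≠ 0, Ω_p, L)` with `IsCWBDPLFunction … L` and every class `z` with `TransferInputs … 1 z L`
(then `z` is determined up to `Λˣ`, p678685), `∃ k, (p^k)·char_t(X_+) ⊆ ι(char(Sel_+(K, 𝐓^ac)/Λz))²`, on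
C⁺⁺_NS's binders (`p ≥ 5` good, `a_p = 0`, `ρ̄` onto, `K` imaginary quadratic, `p = 𝔭𝔭̄` split, every
`ℓ ∣ N` split, `(N, D_K) = 1`, `p ∤ h_K`, `N` NOT square-free, `E[p]` ramified at every `q ∣ N`) — and the
ranks are DERIVED from print instead of assumed:
* `three_lt_of_isNewformOf` — a newform of level `N` for `W` forces `N ∉ {1,…,10,12,13,16,18,25}`, so
  `3 < N` (`nonempty_modularParametrizationData_of_isNewformOf` + genus-zero emptiness); this replaces
  the modularity datum the crux binders carry but C⁺⁺_NS does not;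
* `X_hasRank_sgn_one_of_longoVigni` — `X_ε` of `Λ`-rank one from Longo–Vigni 2019 Thm 1.4 (conjunct 2)
  transported to Kim's carrier (`…XAcTorsionSignedRank`, `…XAcTorsionSignedCarrier`; the lineage's
  `xAcTorsionSS_of_longoVigni_castellaWan` argument, here for every sign and in C⁺⁺_NS's binder frame);
* `chkllPlusRatNS_of_formTBeta` — **C⁺⁺_NS (its registered text, `AdmdefLine.CHKLLPlusRatNS` unfolded)
  from Form T_β + conjunct 2 (LV19 1.4) + conjunct 3 (CW24 proof-of-6.8 inputs) + CW24 Lemma 6.7 (1)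
  (`castellaWan2024_lemma67_finrank_torsionCharIdeal`, refereed; gives `hinj` with NO Tamagawa binder via
  `…TransferSideInjective`) + CW24 "`Sel^{±,rel} ≤ Sel_±`" (`castellaWan2024_proofThm68_selmerRel_le_selmerSgn`,
  refereed; gives `hEq`)**, through the width seat's Eisenstein transfer p634573
  (`…EisensteinTransfer.TransferInputs.span_pow_mul_XAc_charIdeal_map_le_span`).
So the `±`-currency research residue of cell β is Form T_β (well-posed), at the price of two refereed
Castella–Wan facts beyond the cite stub of admdef v2; by CHKLL25 Thm 7.4/7.5 (stated at arbitrary `N`,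
LEAD memo `Lines/admdef-lead-g15.md` §5) Form T_β with `k = 0` follows from the non-vanishing of one
`λ±_j(m)` — the card's K3/T5′. Nothing is registered by this file (the skeleton of record keeps C⁺⁺_NS).

All PROVED (standard axioms); no definition, no named fact, no `sorry`. BSD / the crux / C⁺⁺_NS /
Form T_β are NOT proved by this file.
-/

-- D-0017: single-problem summit, the namespace repeats the problem name by design.
set_option linter.dupNamespace false
set_option autoImplicit false

noncomputable section

open scoped Classical NumberField

open NumberField IsDedekindDomain Field CongruenceSubgroup
  Literature.NumberTheory.EllipticCurves Literature.NumberTheory.EllipticCurves.ModularForms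
  Literature.NumberTheory.EllipticCurves.Rank1Residual Literature.NumberTheory.EllipticCurves.AcSigned
  Literature.NumberTheory.EllipticCurves.Kobayashi2003 Literature.NumberTheory.EllipticCurves.CastellaWan2024
  Literature.NumberTheory.GaloisRepresentations
  Summit.BirchSwinnertonDyer.BirchSwinnertonDyer.Theorems

namespace Summit.BirchSwinnertonDyer.BirchSwinnertonDyer.Theorems.SignedBaseChangeAcDivAdmdefFormTBeta

/-! ## §1 `3 < N` from a newform of level `N` -/

/-- **A newform of level `N` attached to `W` forces `3 < N`**: the datum `ModularParametrizationData W N`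
it yields (`nonempty_modularParametrizationData_of_isNewformOf`) is empty at the genus-zero levels
`1, …, 10, 12, 13, 16, 18, 25` (`ModularParametrizationData_isEmpty_of_mem_genusZeroLevels`).
[cite: DiamondShurman2005, Thm. 3.5.1] -/
theorem three_lt_of_isNewformOf {N : ℕ} [NeZero N] {W : WeierstrassCurve ℚ} [W.IsElliptic]
    {f : CuspForm (Gamma0 N) 2} (hf : IsNewformOf W f) : 3 < N := by
  by_contra hle
  push Not at hle
  have hN0 : N ≠ 0 := NeZero.ne N
  have hmem : N ∈ ({1, 2, 3, 4, 5, 6, 7, 8, 9, 10, 12, 13, 16, 18, 25} : Finset ℕ) := by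
    interval_cases N <;> simp_all
  exact (ModularParametrizationData_isEmpty_of_mem_genusZeroLevels W N hmem).false
    (Literature.NumberTheory.Automorphic.nonempty_modularParametrizationData_of_isNewformOf hf).some

/-! ## §2 `X_ε` of `Λ`-rank one from Longo–Vigni Thm 1.4, in the C⁺⁺ binder frame -/

section Ranks

variable {N : ℕ} [NeZero N] {W : WeierstrassCurve ℚ} [W.IsElliptic] [W.IsGloballyMinimal] {K : Type}
  [Field K] [NumberField K] {p : ℕ} [Fact p.Prime] {κ : ZpExtension K p}
  {𝔭 𝔭bar : HeightOneSpectrum (𝓞 K)}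

/-- **`X_ε(E/K_∞)` is finitely generated of `Λ`-rank one for every sign**, GRANTED Longo–Vigni 2019
Thm 1.4 at `(W, K, p, κ, 𝔭, 𝔭̄)` (conjunct 2 of the cite stub), from: the `Setting` (good supersingular
`p` with `a_p = 0`, `K` imaginary quadratic, `p = 𝔭𝔭̄` split, `κ` anticyclotomic, `p ∤ h_K`), a newform
of level `N = N_E` (⟹ `3 < N`), every `ℓ ∣ N` split (Heeg), `5 ≤ p`, `ρ̄_{E,p}` onto (⟹ no CM and
`ρ_{E,p^∞}` onto by Serre). Transport Kobayashi ↦ Kim carrier as in `…XAcTorsionOfLongoVigni`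
(`E(K_{∞,w})[p^∞] = 0` at both `w ∣ p`). [cite: LongoVigni2019, Thm. 1.4] [cite: Kobayashi2003, Def. 1.1] -/
theorem X_hasRank_sgn_one_of_longoVigni
    (hLV : longoVigni2019_thm14_signedSelmerDual_rank_one W K p κ 𝔭 𝔭bar)
    (hS : Setting W K p κ 𝔭 𝔭bar) {f : CuspForm (Gamma0 N) 2} (hf : IsNewformOf W f)
    (hN : (W.conductorNorm ℤ : ℕ) = N) (hHg : SatisfiesHeegnerHypothesis N K) (hp : 5 ≤ p)
    (hs : Surj W p) {γ : absoluteGaloisGroup K} (hγ : κ.IsTopGenerator γ) (ε : ℤˣ) :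
    X.HasRank (W.baseChange K) p κ ∅ (fun _ ↦ .sgn ε) hγ 1 := by
  have hprime : p.Prime := Fact.out
  have hp2 : p ≠ 2 := by omega
  haveI : (W.baseChange K).IsElliptic := by rw [WeierstrassCurve.baseChange]; infer_instance
  have hS' : Setting W K p κ 𝔭bar 𝔭 :=
    ⟨inferInstance, hS.p_ne_two, hS.goodSS, hS.frobeniusTrace_eq_zero, hS.isImaginaryQuadratic, hS.mem', hS.mem,
      fun h ↦ hS.ne h.symm, hS.anticyclotomic, hS.not_dvd_classNumber⟩
  have h3N : 3 < N := three_lt_of_isNewformOf hf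
  have hCM : ¬ W.HasCM := fun hCM ↦ W.not_hasSurjectiveModNGaloisRep_of_hasCM hCM hprime hp2 hs
  have hbig : ∀ u : Module.End ℤ_[p] (W.tateModule p), IsUnit u → u ∈ Set.range (W.galoisRepTate p) :=
    fun u hu ↦ ThreeAdicImageOverK.mem_range_galoisRepTate_of_forall_hasSurjectiveModNGaloisRep W p
      (serre_hasSurjectiveModNGaloisRep_pow_holds W p hp hs) u hu
  -- `E(K_{∞,w})[p^∞] = 0` at both primes above `p`
  have hNT : ∀ w : HeightOneSpectrum (𝓞 K), ((p : ℕ) : 𝓞 K) ∈ w.asIdeal →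
      FixedPoints.addSubgroup ↥(GreenbergSelmer.decomp w ⊓ κ.kerSubgroup)
        ((W.baseChange K).geomPrimaryTorsion p) = ⊥ := by
    intro w hw
    rcases GreenbergFullAtSelmer.eq_or_eq_of_natCast_mem_of_ne hS.isImaginaryQuadratic.1 hS.mem hS.mem'
      hS.ne hw with rfl | rfl
    · exact UniversalToricDescentSignedSetting.fixedPoints_decomp_inf_kerSubgroup_geomPrimaryTorsion_eq_bot_of_setting
        W K p κ _ 𝔭bar hS
    · exact UniversalToricDescentSignedSetting.fixedPoints_decomp_inf_kerSubgroup_geomPrimaryTorsion_eq_bot_of_setting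
        W K p κ _ 𝔭 hS'
  have heq := SignedBaseChangeAcDivXAcTorsionCarrier.selmer_sgn_eq_signedSelmerInfty (W.baseChange K) κ hp2 ε hNT
  have hD := hLV hS N hN h3N hHg hp hCM hbig γ hγ ε (signedSelmerDualData (W.baseChange K) κ ε hγ)
  exact SignedBaseChangeAcDivXAcTorsionCarrier.X.hasRank_sgn_of_signedSelmerDual (W.baseChange K) p κ hγ ε heq hD

end Ranks

/-! ## §3 C⁺⁺_NS from Form T_β and four printed facts -/

/-- **THE CORRECTED CERTIFIED CUT (PROVED): C⁺⁺_NS ⟸ Form T_β + LV19 Thm 1.4 + CW24 proof-of-Thm-6.8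
inputs + CW24 Lemma 6.7 (1) + CW24 "`Sel^{±,rel} ≤ Sel_±`".**  Conclusion = the registered text of
`stub_chkllPlusRatNS` (line `admdef` v2), i.e. `AdmdefLine.CHKLLPlusRatNS` unfolded.  Hypothesis `hT` =
Form T_β: C⁺⁺_NS's binders, then for every non-split datum `(h𝔭, γ𝔭, hγ𝔭)`, every Castella–Wan frame
`(Ω_K ≠ 0, Ω_p, L)` with `IsCWBDPLFunction ι 𝔭 κ γ f D_K Ω_K Ω_p L`, and every class `z ∈ Sel_+(K, 𝐓^ac)`
with `TransferInputs (W⁄K) p κ γ _ 𝔭 h𝔭 γ𝔭 hγ𝔭 𝔭̄ _ _ 1 z L`: `∃ k, span{C(p^k)} * char_t(X_+) ≤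
ι(char(Sel_+/Λz))²`.  Assembly: `Setting` from the binders; `𝔭` non-split in `K_∞` from `p ∤ h_K`
(`…AnticyclotomicNonsplit`, p632042) and a matching local generator; frame and class from conjunct 3 at
the sign `+`; `hX` by §2; `hinj` by `…TransferSideInjective.locSignedAt_injective_of_lemma67`; `hEq` from
the relaxed-equality fact fed with `finrank Sel_+ = 1` (Lemma 6.7 (1)) and `hX`; Form T_β gives the
reversed inequality with slack `k`; then p634573 pushes it to `(p^k)·Ch_Λ(X_ac)·R₀⟦T⟧ ⊆ (L)` along `j`.
[cite: CastellaWan2023, Thm. 6.8 and its proof (6.12)–(6.16), Lemma 6.7 (MS pp. 28–31)]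
[cite: LongoVigni2019, Thm. 1.4] [cite: CastellaEtAl2025, Thm. 7.1 / Cor. 7.2 (arXiv:2308.10474v2 p. 29)] -/
theorem chkllPlusRatNS_of_formTBeta
    (h2 : ∀ (W : WeierstrassCurve ℚ) [W.IsGloballyMinimal] (K : Type) [Field K] [NumberField K]
      (p : ℕ) [Fact p.Prime] (κ : ZpExtension K p) (𝔭 𝔭' : HeightOneSpectrum (𝓞 K)),
      longoVigni2019_thm14_signedSelmerDual_rank_one W K p κ 𝔭 𝔭')
    (h3 : ∀ (N : ℕ) [NeZero N] (W : WeierstrassCurve ℚ) [W.IsGloballyMinimal] (K : Type) [Field K] [NumberField K]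
      (p : ℕ) [Fact p.Prime] (κ : ZpExtension K p) (𝔭 𝔭' : HeightOneSpectrum (𝓞 K)),
      castellaWan2024_proofThm68_transferInputs N W K p κ 𝔭 𝔭')
    (h67 : ∀ (N : ℕ) [NeZero N] (W : WeierstrassCurve ℚ) [W.IsGloballyMinimal] (K : Type) [Field K] [NumberField K]
      (p : ℕ) [Fact p.Prime] (κ : ZpExtension K p) (𝔭 𝔭' : HeightOneSpectrum (𝓞 K)),
      castellaWan2024_lemma67_finrank_torsionCharIdeal N W K p κ 𝔭 𝔭')
    (h5 : ∀ (N : ℕ) [NeZero N] (W : WeierstrassCurve ℚ) [W.IsGloballyMinimal] (K : Type) [Field K] [NumberField K]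
      (p : ℕ) [Fact p.Prime] (κ : ZpExtension K p) (𝔭 𝔭' : HeightOneSpectrum (𝓞 K)),
      castellaWan2024_proofThm68_selmerRel_le_selmerSgn N W K p κ 𝔭 𝔭')
    (hT : ∀ {p : ℕ} [Fact p.Prime] (ι : PadicAlgCl p ≃+* ℂ) (W : WeierstrassCurve ℚ) [W.IsElliptic]
      [W.IsGloballyMinimal] (K : Type) [Field K] [NumberField K]
      (𝔭 𝔭bar : HeightOneSpectrum (𝓞 K)) (κ : ZpExtension K p) (γ : absoluteGaloisGroup K)
      [hγF : Fact (κ.IsTopGenerator γ)] {N : ℕ} [NeZero N] {f : CuspForm (Gamma0 N) 2}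
      (_ : IsNewformOf W f),
      (N : ℤ) = W.conductorNorm ℤ → 5 ≤ p → W.HasGoodReductionAtPrime p → W.frobeniusTrace p = 0 →
      Surj W p →
      IsImaginaryQuadratic K → ((Ideal.span {(p : ℤ)}).primesOver (𝓞 K)).ncard = 2 →
        ((p : ℕ) : 𝓞 K) ∈ 𝔭.asIdeal →
        (∀ (w : InfinitePlace K) (k : 𝓞 K), k ∈ 𝔭.asIdeal ↔ ‖ι.symm (w.embedding (k : K))‖ < 1) →
        ((p : ℕ) : 𝓞 K) ∈ 𝔭bar.asIdeal → (hne : 𝔭bar ≠ 𝔭) →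
      (∀ ℓ : ℕ, ℓ.Prime → ℓ ∣ N → ((Ideal.span {(ℓ : ℤ)}).primesOver (𝓞 K)).ncard = 2) →
      IsCoprime (N : ℤ) (NumberField.discr K) → ¬ p ∣ NumberField.classNumber K →
      ¬ Squarefree N →
      (∀ q : ℕ, q.Prime → q ∣ N →
        ∃ v : HeightOneSpectrum (𝓞 ℚ), ((q : ℕ) : 𝓞 ℚ) ∈ v.asIdeal ∧
          ∃ 𝔓 ∈ v.primesAbove, ∃ σ ∈ 𝔓.inertia (absoluteGaloisGroup ℚ),
            ∃ P : W.geomTorsion (p : ℤ), σ • P ≠ P) →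
      κ.IsAnticyclotomic →
      ∀ (h𝔭 : IsNonsplitIn κ 𝔭) (γ𝔭 : absoluteGaloisGroup (𝔭.adicCompletion K))
        (hγ𝔭 : κ (resGalOfEmb (closureEmb (K := K) (𝔭.adicCompletion K)) γ𝔭) = κ γ)
        (ΩK : ℂ) (Ωp : (unrIntegers p)ˣ) (L : UnrSeries p), ΩK ≠ 0 →
        IsCWBDPLFunction ι 𝔭 κ γ f (NumberField.discr K) ΩK ((Ωp : unrIntegers p) : ℂ_[p]) L →
        ∀ (h𝔭p : ((p : ℕ) : 𝓞 K) ∈ 𝔭.asIdeal)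
          (z : selmerLambdaAdic (W.baseChange K) p κ γ (fun _ ↦ .sgn 1)),
          TransferInputs (W.baseChange K) p κ γ hγF.out 𝔭 h𝔭 γ𝔭 hγ𝔭 𝔭bar (fun h ↦ hne h.symm) h𝔭p 1 z L →
          ∃ k : ℕ, Ideal.span {PowerSeries.C ((p : ℤ_[p]) ^ k)} *
              X.torsionCharIdeal (W.baseChange K) p κ ∅ (fun _ ↦ .sgn 1) hγF.out ≤
            (signedHeegnerCharIdeal hγF.out 1 z).map (IwasawaAlgebra.invol p) ^ 2) :
    ∀ {p : ℕ} [Fact p.Prime] (ι : PadicAlgCl p ≃+* ℂ) (W : WeierstrassCurve ℚ) [W.IsElliptic]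
      [W.IsGloballyMinimal] (K : Type) [Field K] [NumberField K]
      (𝔭 𝔭bar : HeightOneSpectrum (𝓞 K)) (κ : ZpExtension K p) (γ : absoluteGaloisGroup K)
      [Fact (κ.IsTopGenerator γ)] {N : ℕ} [NeZero N] {f : CuspForm (Gamma0 N) 2}
      (_ : IsNewformOf W f),
      (N : ℤ) = W.conductorNorm ℤ → 5 ≤ p → W.HasGoodReductionAtPrime p → W.frobeniusTrace p = 0 →
      Surj W p →
      IsImaginaryQuadratic K → ((Ideal.span {(p : ℤ)}).primesOver (𝓞 K)).ncard = 2 →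
        ((p : ℕ) : 𝓞 K) ∈ 𝔭.asIdeal →
        (∀ (w : InfinitePlace K) (k : 𝓞 K), k ∈ 𝔭.asIdeal ↔ ‖ι.symm (w.embedding (k : K))‖ < 1) →
        ((p : ℕ) : 𝓞 K) ∈ 𝔭bar.asIdeal → 𝔭bar ≠ 𝔭 →
      (∀ ℓ : ℕ, ℓ.Prime → ℓ ∣ N → ((Ideal.span {(ℓ : ℤ)}).primesOver (𝓞 K)).ncard = 2) →
      IsCoprime (N : ℤ) (NumberField.discr K) → ¬ p ∣ NumberField.classNumber K →
      ¬ Squarefree N →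
      (∀ q : ℕ, q.Prime → q ∣ N →
        ∃ v : HeightOneSpectrum (𝓞 ℚ), ((q : ℕ) : 𝓞 ℚ) ∈ v.asIdeal ∧
          ∃ 𝔓 ∈ v.primesAbove, ∃ σ ∈ 𝔓.inertia (absoluteGaloisGroup ℚ),
            ∃ P : W.geomTorsion (p : ℤ), σ • P ≠ P) →
      κ.IsAnticyclotomic →
      ∃ (ΩK : ℂ) (Ωp : (unrIntegers p)ˣ) (L : UnrSeries p),
        ΩK ≠ 0 ∧
        IsCWBDPLFunction ι 𝔭 κ γ f (NumberField.discr K) ΩK ((Ωp : unrIntegers p) : ℂ_[p]) L ∧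
        ∀ (j : ℤ_[p] →+* unrIntegers p),
          (∀ x : ℤ_[p], ((j x : unrIntegers p) : ℂ_[p]) = algebraMap ℚ_[p] ℂ_[p] (x : ℚ_[p])) →
          ∃ k : ℕ,
            Ideal.span {PowerSeries.C ((p : unrIntegers p) ^ k)} *
                (Castella2018.AcSelmer.XAc.charIdeal (W.baseChange K) p κ 𝔭bar ∅ γ).map (PowerSeries.map j) ≤
              Ideal.span {L} := by
  intro p _ ι W _ _ K _ _ 𝔭 𝔭bar κ γ hγF N _ f hf hN hp hgood hap hsurj hK hsplit h𝔭 hι h𝔭bar hne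
    hHeeg hcop hh hnsq hram hac
  have hprime : p.Prime := Fact.out
  have hp2 : p ≠ 2 := by omega
  have h3p : 3 < p := by omega
  have hS : Setting W K p κ 𝔭 𝔭bar :=
    { isElliptic := ‹_›
      p_ne_two := hp2
      goodSS := ⟨hgood, by rw [hap]; exact dvd_zero _⟩
      frobeniusTrace_eq_zero := hap
      isImaginaryQuadratic := hK
      mem := h𝔭
      mem' := h𝔭bar
      ne := hne
      anticyclotomic := hac
      not_dvd_classNumber := hh }
  have hN' : (W.conductorNorm ℤ : ℕ) = N := by exact_mod_cast hN.symm
  have hHg : SatisfiesHeegnerHypothesis N K := fun ℓ hℓ hℓN ↦ hHeeg ℓ hℓ hℓN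
  haveI : (W.baseChange K).IsElliptic := by rw [WeierstrassCurve.baseChange]; infer_instance
  -- `𝔭` does not split in `K_∞⁻` (from `p ∤ h_K`) and a matching local generator
  have hns : IsNonsplitIn κ 𝔭 :=
    SignedBaseChangeAcDivAnticyclotomicNonsplit.isNonsplitIn_of_isAnticyclotomic_of_not_dvd_classNumber
      hK hp2 κ hac hh h𝔭
  obtain ⟨γ𝔭, hγ𝔭⟩ := hns (κ γ)
  -- frame and class at the sign `+` (conjunct 3)
  obtain ⟨ΩK, Ωp, L, hΩ, hBDP, hz⟩ := h3 N W K p κ 𝔭 𝔭bar hS ι hf hN' hHg h3p hι γ hγF.out hns γ𝔭 hγ𝔭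
  refine ⟨ΩK, Ωp, L, hΩ, hBDP, fun j hj ↦ ?_⟩
  obtain ⟨z, hTz⟩ := hz 1
  -- ranks from print: `X_+` (LV19) and `finrank Sel_+ = 1` (CW Lemma 6.7 (1)); `hinj`, `hEq`
  have hX : X.HasRank (W.baseChange K) p κ ∅ (fun _ ↦ .sgn 1) hγF.out 1 :=
    X_hasRank_sgn_one_of_longoVigni (h2 W K p κ 𝔭 𝔭bar) hS hf hN' hHg hp hsurj hγF.out 1
  have hfin : (letI := selmerLambdaAdic.moduleOfGen (W.baseChange K) p κ γ hγF.out (fun _ ↦ PCond.sgn 1)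
      Module.finrank (IwasawaAlgebra p) (selmerLambdaAdic (W.baseChange K) p κ γ (fun _ ↦ .sgn 1))) = 1 :=
    SignedBaseChangeAcDivTransferSideInjective.finrank_selmerLambdaAdic_sgn_eq_one_of_lemma67
      (h67 N W K p κ 𝔭 𝔭bar) hS hN' hHg h3p hγF.out 1 hX
  have hinj := SignedBaseChangeAcDivTransferSideInjective.locSignedAt_injective_of_lemma67
    (h67 N W K p κ 𝔭 𝔭bar) hS hN' hHg h3p hTz hX
  have hRel := h5 N W K p κ 𝔭 𝔭bar hS ι hf hN' hHg h3p hι γ hγF.out 1 hfin hX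
  have hEq : ∀ x' : selmerLambdaAdic (W.baseChange K) p κ γ (PCond.at 𝔭bar .rel (.sgn 1)),
      ∃ x : selmerLambdaAdic (W.baseChange K) p κ γ (fun _ ↦ .sgn 1),
        locSignedAt (W.baseChange K) p κ 𝔭 hns γ γ𝔭 hγ𝔭 (fun _ ↦ .sgn 1) 1 rfl h𝔭 x =
          locSignedAt (W.baseChange K) p κ 𝔭 hns γ γ𝔭 hγ𝔭 (PCond.at 𝔭bar .rel (.sgn 1)) 1
            (PCond.at_of_ne .rel (.sgn 1) (fun h ↦ hne h.symm)) h𝔭 x' :=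
    fun x' ↦ ⟨⟨x'.1, hRel x'.2⟩, Subtype.ext rfl⟩
  -- Form T_β: the reversed inequality with slack
  obtain ⟨k, hk⟩ := hT ι W K 𝔭 𝔭bar κ γ hf hN hp hgood hap hsurj hK hsplit h𝔭 hι h𝔭bar hne hHeeg hcop hh hnsq
    hram hac hns γ𝔭 hγ𝔭 ΩK Ωp L hΩ hBDP h𝔭 z hTz
  have hCp : PowerSeries.C ((p : ℤ_[p]) ^ k) = ((p : ℕ) : IwasawaAlgebra p) ^ k := by
    rw [map_pow, map_natCast]
  have hCu : PowerSeries.C ((p : unrIntegers p) ^ k) = ((p : ℕ) : UnrSeries p) ^ k := by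
    rw [map_pow, map_natCast]
  rw [hCp] at hk
  refine ⟨k, ?_⟩
  rw [hCu]
  exact SignedBaseChangeAcDivEisensteinTransfer.TransferInputs.span_pow_mul_XAc_charIdeal_map_le_span
    hTz h𝔭bar hinj hX hEq hk j hj

end Summit.BirchSwinnertonDyer.BirchSwinnertonDyer.Theorems.SignedBaseChangeAcDivAdmdefFormTBeta

end
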